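import Mathlib
import HarnessLib
import Summits.ResolutionOfSingularities.ResolutionOfSingularities.Theorems.WildQuotientsWildQuotientResolutionS1aOneShotKillV5
import Summits.ResolutionOfSingularities.ResolutionOfSingularities.Theorems.WildQuotientsWildQuotientResolutionS1aOneShotKillChartShift

/-!
# S1a — (T2 V5, chart form) ONE-SHOT KILL on `R^w[(bT^d)⁻¹]` with TRIANGULAR hits (`ChartOneShotKillV5`, plan-1 SIG `W45cT2KillV5.lean`)

[OURS · L1 W4.5c · lead-1 g7; plan-1 ASSIGNMENT v10.5 (3)] — NOT statements of the manuscript; counted 0; AI-level work, weaker than expert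
review. Crux stmt-ResolutionOfSingularities-17941, line `s1a-logminvertex` v6, producer side of `NodeAtlas.IsPrincipalCentreChart`.

* `triangularError f w δ h i = K(w_h+δ+1) ⊔ ⨆_{j<i} (f_j)·K(w_h+δ−w_j)` (plan-1ʼs definition, verbatim);
* `map_triangularError_le` — in a chart ring with `f_j ↦ g_j e^{w_j}`, `K n ↦ (eⁿ)`: the image of `triangularError` lies in
  `(e^{w_h+δ}) · priorIdeal g e i`;
* `unitSuccessorFormula_triangular` — the hit `σ f_h − f_h − ε u f_i^k = ε t`, `t ∈ triangularError`, `k w_i = w_h + δ`, descends to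
  `τ g_h − g_h − ε u g_i^k e^δ ∈ (ε e^δ) · priorIdeal g e i`;
* **`augmentationIdeal_sigmaChart_eq_span_triangular`** — `ChartOneShotKillV5`: `augmentationIdeal σʼ = (ε s^δ)` on EVERY chart ring
  `R^w[(bT^d)⁻¹]` (`b ∈ K d` σ-invariant, `1 ≤ d`), via `augmentationIdeal_eq_span_of_oneShotV5`.
-/

set_option linter.dupNamespace false

noncomputable section

open LaurentPolynomial
open Literature.AlgebraicGeometry.Resolution
open Summit.ResolutionOfSingularities.ResolutionOfSingularities.Theorems.WildQuotientResolution.S1.CoarseChart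

namespace Summit.ResolutionOfSingularities.ResolutionOfSingularities.Theorems.WildQuotientResolution.S1.OneShotKill

universe u v

/-- The upstairs TRIANGULAR error ideal for a hit `h ⟵ i`: `K(w_h + δ + 1) + Σ_{j < i} f_j · K(w_h + δ − w_j)`
(plan-1 SIG `W45cT2KillV5`). [OURS · L1 W4.5c] -/
def triangularError {B : Type u} [CommRing B] {c : ℕ} (f : Fin c → B) (w : Fin c → ℕ) (δ : ℕ) (h i : Fin c) : Ideal B :=
  (weightedFiltration f w).ideal (w h + δ + 1) ⊔
    ⨆ j ∈ {j : Fin c | j < i}, Ideal.span {f j} * (weightedFiltration f w).ideal (w h + δ - w j)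

section Abstract

variable {B C : Type u} [CommRing B] [CommRing C] [Algebra B C] (σ : B ≃+* B) (τ : C ≃+* C)
  {c : ℕ} (f : Fin c → B) (w : Fin c → ℕ) (g : Fin c → C) (e : C)

/-- In the chart ring the triangular error lies in `(e^{w_h+δ}) · priorIdeal g e i`. -/
theorem map_triangularError_le (hfg : ∀ j, algebraMap B C (f j) = g j * e ^ (w j))
    (hK : ∀ (n : ℕ) (y : B), y ∈ (weightedFiltration f w).ideal n → algebraMap B C y ∈ Ideal.span {e ^ n}) (δ : ℕ) (h i : Fin c) :
    (triangularError f w δ h i).map (algebraMap B C) ≤ Ideal.span {e ^ (w h + δ)} * priorIdeal g e i := by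
  have hKmap : ∀ n : ℕ, ((weightedFiltration f w).ideal n).map (algebraMap B C) ≤ Ideal.span {e ^ n} := fun n => by
    rw [Ideal.map_le_iff_le_comap]
    intro y hy
    exact hK n y hy
  have heP : e ∈ priorIdeal g e i := Ideal.subset_span (Set.mem_insert _ _)
  have hgP : ∀ j, j < i → g j ∈ priorIdeal g e i := fun j hj => Ideal.subset_span (Set.mem_insert_of_mem _ ⟨j, hj, rfl⟩)
  rw [triangularError, Ideal.map_sup, Ideal.map_iSup]
  refine sup_le ?_ (iSup_le fun j => ?_)
  · refine (hKmap _).trans ?_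
    rw [Ideal.span_singleton_le_iff_mem, pow_succ]
    exact Ideal.mul_mem_mul (Ideal.mem_span_singleton_self _) heP
  · rw [Ideal.map_iSup]
    refine iSup_le fun hj => ?_
    rw [Ideal.map_mul, Ideal.map_span, Set.image_singleton, hfg j]
    refine (Ideal.mul_mono_right (hKmap _)).trans ?_
    rw [Ideal.span_singleton_mul_span_singleton, Ideal.span_singleton_le_iff_mem]
    obtain ⟨r, hr⟩ : ∃ r, w j + (w h + δ - w j) = (w h + δ) + r := ⟨w j + (w h + δ - w j) - (w h + δ), by omega⟩
    have : g j * e ^ w j * e ^ (w h + δ - w j) = e ^ (w h + δ) * (g j * e ^ r) := by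
      rw [mul_assoc, ← pow_add, hr, pow_add]; ring
    rw [this]
    exact Ideal.mul_mem_mul (Ideal.mem_span_singleton_self _) (Ideal.mul_mem_right _ _ (hgP j (Set.mem_setOf.mp hj)))

/-- **HIT FORMULA, triangular form**: `σ f_h − f_h − ε u f_i^k = ε t`, `t ∈ triangularError f w δ h i`, `k w_i = w_h + δ` descend to
`τ g_h − g_h − ε u g_i^k e^δ ∈ (ε e^δ) · priorIdeal g e i`. [OURS · L1 W4.5c] -/
theorem unitSuccessorFormula_triangular (hcompat : ∀ b : B, τ (algebraMap B C b) = algebraMap B C (σ b))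
    (he : e ∈ nonZeroDivisors C) (hτe : τ e = e) (hfg : ∀ j, algebraMap B C (f j) = g j * e ^ (w j))
    (hK : ∀ (n : ℕ) (y : B), y ∈ (weightedFiltration f w).ideal n → algebraMap B C y ∈ Ideal.span {e ^ n})
    (ε : B) (δ : ℕ) (h i : Fin c) (u : B) (k : ℕ) (hk : k * w i = w h + δ)
    (t : B) (ht : t ∈ triangularError f w δ h i) (hrel : σ (f h) - f h - ε * u * f i ^ k = ε * t) :
    τ (g h) - g h - algebraMap B C ε * algebraMap B C u * g i ^ k * e ^ δ ∈
      Ideal.span {algebraMap B C ε * e ^ δ} * priorIdeal g e i := by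
  have hT : algebraMap B C t ∈ Ideal.span {e ^ (w h + δ)} * priorIdeal g e i :=
    map_triangularError_le f w g e hfg hK δ h i (Ideal.mem_map_of_mem _ ht)
  obtain ⟨m, hm, hmeq⟩ := Ideal.mem_span_singleton_mul.mp hT
  -- the relation in `C`, divided by `e^{w_h}`
  have hrel' := congrArg (algebraMap B C) hrel
  rw [map_sub, map_sub, ← hcompat] at hrel'
  simp only [map_mul, map_pow, hfg, hτe] at hrel'
  rw [← hmeq] at hrel'
  have hewh : e ^ w h ∈ nonZeroDivisors C := pow_mem he (w h)
  have key : (τ (g h) - g h - algebraMap B C ε * algebraMap B C u * g i ^ k * e ^ δ) * e ^ w h =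
      (algebraMap B C ε * e ^ δ * m) * e ^ w h := by
    have e1 : (g i * e ^ w i) ^ k = g i ^ k * (e ^ δ * e ^ w h) := by
      rw [mul_pow, ← pow_mul, mul_comm (w i) k, hk, pow_add, mul_comm (e ^ w h)]
    rw [e1] at hrel'
    have e2 : e ^ (w h + δ) = e ^ δ * e ^ w h := by rw [pow_add, mul_comm]
    rw [e2] at hrel'
    linear_combination hrel'
  rw [(mul_cancel_right_mem_nonZeroDivisors hewh).mp key]
  exact Ideal.mul_mem_mul (Ideal.mem_span_singleton_self _) hm

/-- Units modulo `(e)` are units modulo the prior ideal (which contains `e`). -/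
theorem isUnit_mk_priorIdeal_of_isUnit_mk_span {u : C} (hu : IsUnit (Ideal.Quotient.mk (Ideal.span {e}) u)) (i : Fin c) :
    IsUnit (Ideal.Quotient.mk (priorIdeal g e i) u) := by
  have hle : Ideal.span {e} ≤ priorIdeal g e i := by
    rw [Ideal.span_singleton_le_iff_mem]; exact Ideal.subset_span (Set.mem_insert _ _)
  have := hu.map (Ideal.Quotient.factor hle)
  rwa [Ideal.Quotient.factor_mk] at this

end Abstract

section Chart

variable {ι : Type v} [AddCommGroup ι] [DecidableEq ι] {B : Type u} [CommRing B]
  (𝒜 : ι → AddSubgroup B) [GradedRing 𝒜] {c : ℕ} (f : Fin c → B) (w : Fin c → ℕ)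
  (d : ℕ) (b : ↥(𝒜 0)) (hb : b ∈ (traceFiltration 𝒜 f w).ideal d) (σ : B ≃+* B)
  (hσJ : ∀ n : ℕ, ((weightedFiltration f w).ideal n).map (σ : B →+* B) ≤ (weightedFiltration f w).ideal n)
  {p : ℕ} (hp : 0 < p) (hσp : ∀ x : B, (⇑σ)^[p] x = x) (hσb : σ (b : B) = b) (ε : B) (δ : ℕ)

include hp hσp in
/-- **(T2 V5, chart form) ONE-SHOT KILL with TRIANGULAR hits** on `R^w[(bT^d)⁻¹]`: `augmentationIdeal σʼ = (ε s^δ)`. Hypotheses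
(`ChartOneShotKillV5`): `1 ≤ d`; gr-shift data `σ y − y ∈ ε K δ` (all `y`) and `σ f_i − f_i ∈ ε K (w_i + δ)`; radical clause
`ε f_i^N ∈ I_σ`; every `i` BOTTOM (`w_i = δ`, `ε f_i ∈ I_σ`) or TRIANGULARLY HIT (`σ f_h − f_h − ε u f_i^k = ε t`,
`t ∈ triangularError f w δ h i`, `k w_i = w_h + δ`, `u` a unit mod `K 1`). [OURS · L1 W4.5c] -/
theorem augmentationIdeal_sigmaChart_eq_span_triangular (hd : 1 ≤ d)
    (h1 : ∀ y : B, ∃ t ∈ (weightedFiltration f w).ideal δ, σ y - y = ε * t)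
    (hdepth : ∀ i, ∃ t ∈ (weightedFiltration f w).ideal (w i + δ), σ (f i) - f i = ε * t)
    (hrad : ∀ i, ∃ N : ℕ, ε * f i ^ N ∈ augmentationIdeal σ)
    (hrel : ∀ i, (w i = δ ∧ ε * f i ∈ augmentationIdeal σ) ∨ ∃ (h : Fin c) (u : B) (k : ℕ), k * w i = w h + δ ∧
      IsUnit (Ideal.Quotient.mk ((weightedFiltration f w).ideal 1) u) ∧
      ∃ t ∈ triangularError f w δ h i, σ (f h) - f h - ε * u * f i ^ k = ε * t) :
    augmentationIdeal (sigmaChart 𝒜 f w d b hb σ hσJ hp hσp hσb) =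
      Ideal.span {algebraMap _ (ChartRing 𝒜 f w d b hb) (algebraMap B (↥(cobordantAlgebra f w)) ε) *
        algebraMap _ (ChartRing 𝒜 f w d b hb) (cobordantAlgebra.s f w) ^ δ} := by
  letI : Algebra B (ChartRing 𝒜 f w d b hb) :=
    ((algebraMap _ (ChartRing 𝒜 f w d b hb)).comp (algebraMap B (↥(cobordantAlgebra f w)))).toAlgebra
  have halg : ∀ y : B, algebraMap B (ChartRing 𝒜 f w d b hb) y =
      algebraMap _ (ChartRing 𝒜 f w d b hb) (algebraMap B (↥(cobordantAlgebra f w)) y) := fun _ => rfl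
  have hcompat : ∀ y : B, sigmaChart 𝒜 f w d b hb σ hσJ hp hσp hσb (algebraMap B (ChartRing 𝒜 f w d b hb) y) =
      algebraMap B (ChartRing 𝒜 f w d b hb) (σ y) := fun y => by
    rw [halg, halg]; exact sigmaChart_algebraMap_algebraMap 𝒜 f w d b hb σ hσJ hp hσp hσb y
  have hfg : ∀ j, algebraMap B (ChartRing 𝒜 f w d b hb) (f j) =
      algebraMap _ (ChartRing 𝒜 f w d b hb) (cobordantAlgebra.u' f w j) *
        algebraMap _ (ChartRing 𝒜 f w d b hb) (cobordantAlgebra.s f w) ^ (w j) := fun j => by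
    rw [halg, cobordantAlgebra.algebraMap_u, map_mul, map_pow, mul_comm]
  have hK : ∀ (n : ℕ) (y : B), y ∈ (weightedFiltration f w).ideal n →
      algebraMap B (ChartRing 𝒜 f w d b hb) y ∈
        Ideal.span {algebraMap _ (ChartRing 𝒜 f w d b hb) (cobordantAlgebra.s f w) ^ n} := fun n y hy => by
    rw [halg, ← map_pow]
    have := Ideal.mem_map_of_mem (algebraMap _ (ChartRing 𝒜 f w d b hb)) (algebraMap_mem_span_s_pow f w hy)
    rwa [Ideal.map_span, Set.image_singleton] at this
  have hIσ : ∀ y ∈ augmentationIdeal σ, algebraMap B (ChartRing 𝒜 f w d b hb) y ∈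
      augmentationIdeal (sigmaChart 𝒜 f w d b hb σ hσJ hp hσp hσb) := fun y hy =>
    map_augmentationIdeal_le σ _ hcompat (Ideal.mem_map_of_mem _ hy)
  rw [← halg ε]
  refine augmentationIdeal_eq_span_of_oneShotV5 (sigmaChart 𝒜 f w d b hb σ hσJ hp hσp hσb)
    (fun i => algebraMap _ (ChartRing 𝒜 f w d b hb) (cobordantAlgebra.u' f w i)) δ (algebraMap B _ ε)
    (algebraMap _ (ChartRing 𝒜 f w d b hb) (cobordantAlgebra.s f w))
    (span_algebraMap_u'_eq_top 𝒜 f w d b hb hd) ?_ (fun i => ?_) fun i => ?_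
  · -- gr-shift on the chart
    intro x
    have := sigmaChart_sub_mem_span_shift 𝒜 f w d b hb σ hσJ hp hσp hσb ε δ h1 hdepth x
    rwa [← halg] at this
  · -- radical clause: `ε g_i^N e^{N w_i} = ε f_i^N ∈ I_σ`
    obtain ⟨N, hN⟩ := hrad i
    refine ⟨N, N * w i, ?_⟩
    have : algebraMap B (ChartRing 𝒜 f w d b hb) ε *
        algebraMap _ (ChartRing 𝒜 f w d b hb) (cobordantAlgebra.u' f w i) ^ N *
        algebraMap _ (ChartRing 𝒜 f w d b hb) (cobordantAlgebra.s f w) ^ (N * w i) =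
        algebraMap B (ChartRing 𝒜 f w d b hb) (ε * f i ^ N) := by
      rw [map_mul, map_pow, hfg i, mul_pow, ← pow_mul, mul_comm (w i) N, mul_assoc]
    rw [this]; exact hIσ _ hN
  · rcases hrel i with ⟨hbot, hεf⟩ | ⟨h, u, k, hkw, hu, t, ht, hrel'⟩
    · -- bottom: `y := ε f_i = ε g_i e^δ`, `u := 1`, `k := 1`
      refine ⟨algebraMap B _ (ε * f i), 1, 1, hIσ _ hεf, ?_, ?_⟩
      · rw [map_one]; exact isUnit_one
      · have : algebraMap B (ChartRing 𝒜 f w d b hb) (ε * f i) -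
            algebraMap B (ChartRing 𝒜 f w d b hb) ε * 1 *
              algebraMap _ (ChartRing 𝒜 f w d b hb) (cobordantAlgebra.u' f w i) ^ 1 *
              algebraMap _ (ChartRing 𝒜 f w d b hb) (cobordantAlgebra.s f w) ^ δ = 0 := by
          rw [map_mul, hfg i, hbot]; ring
        rw [this]; exact Ideal.zero_mem _
    · refine ⟨_, algebraMap B _ u, k, sub_mem_augmentationIdeal (sigmaChart 𝒜 f w d b hb σ hσJ hp hσp hσb)
        (algebraMap _ (ChartRing 𝒜 f w d b hb) (cobordantAlgebra.u' f w h)),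
        isUnit_mk_priorIdeal_of_isUnit_mk_span _ _
          (isUnit_mk_span_of_isUnit_mk f w (algebraMap _ (ChartRing 𝒜 f w d b hb) (cobordantAlgebra.s f w)) hK hu) i, ?_⟩
      exact unitSuccessorFormula_triangular σ (sigmaChart 𝒜 f w d b hb σ hσJ hp hσp hσb) f w
        (fun i => algebraMap _ (ChartRing 𝒜 f w d b hb) (cobordantAlgebra.u' f w i))
        (algebraMap _ (ChartRing 𝒜 f w d b hb) (cobordantAlgebra.s f w)) hcompat
        (algebraMap_s_mem_nonZeroDivisors 𝒜 f w d b hb) (sigmaChart_s 𝒜 f w d b hb σ hσJ hp hσp hσb)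
        hfg hK ε δ h i u k hkw t ht hrel'

end Chart

end Summit.ResolutionOfSingularities.ResolutionOfSingularities.Theorems.WildQuotientResolution.S1.OneShotKill

end
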